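import Literature.AlgebraicGeometry.Resolution.LogRefinedChartLift
import Literature.AlgebraicGeometry.Resolution.RegularLocalRingsProofs
import Mathlib.RingTheory.Localization.FractionRing
import HarnessLib

/-!
# The group envelope of the chart in the fraction field of `K♯_𝔔` — Kato (10.3)

`Literature/AlgebraicGeometry/Resolution/LogRefinedChartEnvelope.lean`. Continuation of
`LogRefinedChartLift.lean` (K. Kato, *Toric singularities*, Amer. J. Math. 116 (1994), (10.3)).
The refined chart ring `K♯_𝔔` at a point is a regular local ring, hence a domain; in its fraction
field `L`:

* `Hyps` — the standing hypotheses of the identification, bundled;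
* `kvar_ne_zero` — the variables `Tⱼ, T′_k` are non-zero in `K♯_𝔔` (they minimally generate `𝔪`);
* `gA : A → L` and `envelope : ℤⁿ → Lˣ` — the group envelope `Θ` of `p ↦ φ(p)` (Kato (1.1));
* `omega_chi` — any `ω : C → L` over `A` sends `χ(q)` to `Θ(q)`;
* `xi_eq_envelope_proj'` — **the relation `Ξ = Θ ∘ π'`** where `Ξ(x) = T^{b*(x)} X^{b′(x)}`,
  whence `Tⱼ = Θ(b_{i_j})` (`TL_eq`) and `X_k = Θ(h′_k)` (`XL_eq`) in `L`.

References: [Kato1994] K. Kato, Toric singularities, Amer. J. Math. 116 (1994), (1.1), (10.3).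
-/

noncomputable section

open IsLocalRing Literature.RingTheory.MvPowerSeries

namespace Literature.AlgebraicGeometry.Resolution

namespace LogRefinedChart

open LogRegularCompleteStructure

universe u

variable {n : ℕ} {A : Type u} [CommRing A]

/-- **The standing hypotheses**, bundled: `P ⊆ Q`, `χ|_P = φ`, `π₀` a splitting of the face group
at `𝔭 = 𝔓 ∩ A` (`LogChart.IsFaceOf.exists_proj`), `ℤP = ℤⁿ`, `P` finitely generated.
[cite: Kato1994, (10.3)] -/
structure Hyps (P : AddSubmonoid (Fin n → ℤ)) (φ : Multiplicative P →* A) {C : Type u} [CommRing C]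
    [Algebra A C] (Q : AddSubmonoid (Fin n → ℤ)) (χ : Multiplicative Q →* C) (𝔓 : Ideal C)
    [𝔓.IsPrime] (π₀ : (Fin n → ℤ) →ₗ[ℤ] (Fin n → ℤ)) : Prop where
  le : P ≤ Q
  chi : ∀ p : P, χ (Multiplicative.ofAdd ⟨(p : Fin n → ℤ), le p.2⟩) =
    algebraMap A C (φ (Multiplicative.ofAdd p))
  proj_zero : ∀ v ∈ Submodule.span ℤ
    (LogChart.faceMonoid P φ (𝔓.comap (algebraMap A C)) : Set (Fin n → ℤ)), π₀ v = 0
  sub_proj : ∀ v, v - π₀ v ∈ Submodule.span ℤ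
    (LogChart.faceMonoid P φ (𝔓.comap (algebraMap A C)) : Set (Fin n → ℤ))
  proj_proj : ∀ v, π₀ (π₀ v) = π₀ v
  span_eq : Submodule.span ℤ (P : Set (Fin n → ℤ)) = ⊤
  fg : P.FG

variable {P : AddSubmonoid (Fin n → ℤ)}
  {φ : Multiplicative P →* A} {C : Type u} [CommRing C] [Algebra A C]
  {Q : AddSubmonoid (Fin n → ℤ)} {b : Module.Basis (Fin n) ℤ (Fin n → ℤ)} {I : Finset (Fin n)}
  {hQ : IsOrthantLike b I Q} {χ : Multiplicative Q →* C} {𝔓 : Ideal C} [𝔓.IsPrime]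
  {π₀ : (Fin n → ℤ) →ₗ[ℤ] (Fin n → ℤ)} {e : (Fin n → ℤ) →+ (Fin n → ℤ)}
  {he : LogChart.IsSharpEmbedding P (LogChart.faceMonoid P φ (𝔓.comap (algebraMap A C))) e}
  (ℌ : Hyps P φ Q χ 𝔓 π₀) (𝒟 : PointData hQ χ 𝔓 π₀ he)

/-! ### The local ring `K♯_𝔔`, its variables and constants -/

/-- `K♯_𝔔` (abbreviation with bundled hypotheses). [cite: Kato1994, (10.3)] -/
abbrev KL : Type u := KLoc ℌ.le ℌ.chi ℌ.proj_zero 𝒟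

/-- `Λ : K♯_𝔔 → C_𝔓` (abbreviation with bundled hypotheses). [cite: Kato1994, (10.3)] -/
abbrev LamH : KL ℌ 𝒟 →+* Localization.AtPrime 𝔓 := Lam ℌ.le ℌ.chi ℌ.proj_zero ℌ.sub_proj 𝒟

/-- **`K♯_𝔔` is regular.** [cite: Kato1994, (10.3)] -/
instance isRegularLocalRing_KL [IsNoetherianRing A] : IsRegularLocalRing (KL ℌ 𝒟) :=
  (isRegularLocalRing_KLoc ℌ.le ℌ.chi ℌ.proj_zero 𝒟 ℌ.fg).1

/-- `dim K♯_𝔔 = N + d + h`. [cite: Kato1994, (10.3)] -/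
theorem ringKrullDim_KL [IsNoetherianRing A] :
    ringKrullDim (KL ℌ 𝒟) = (refineRank hQ χ 𝔓 + (𝒟.d + 𝒟.h) : ℕ) :=
  (isRegularLocalRing_KLoc ℌ.le ℌ.chi ℌ.proj_zero 𝒟 ℌ.fg).2

/-- **`K♯_𝔔` is a domain.** [cite: Kato1994, Thm. (4.1), (10.3)] -/
instance isDomain_KL [IsNoetherianRing A] : IsDomain (KL ℌ 𝒟) := isDomain_of_isRegularLocalRing (KL ℌ 𝒟)

/-- The structure map `A₁ → K♯ → K♯_𝔔`. [cite: Kato1994, (10.3)] -/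
def toK : TorusLoc A hQ χ 𝔓 π₀ →+* KL ℌ 𝒟 :=
  (algebraMap (KRing 𝒟) (KL ℌ 𝒟)).comp ((Ideal.Quotient.mk _).comp MvPolynomial.C)

/-- `toK` unfolded. [cite: Kato1994, (10.3)] -/
theorem toK_apply (a : TorusLoc A hQ χ 𝔓 π₀) :
    toK ℌ 𝒟 a = algebraMap (KRing 𝒟) (KL ℌ 𝒟) (Ideal.Quotient.mk _ (MvPolynomial.C a)) := rfl

/-- The image of the variable `Xᵢ` of `K♯` in `K♯_𝔔`. [cite: Kato1994, (10.3)] -/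
def kvar (i : Fin (refineRank hQ χ 𝔓 + (𝒟.d + 𝒟.h))) : KL ℌ 𝒟 :=
  algebraMap (KRing 𝒟) (KL ℌ 𝒟) (Ideal.Quotient.mk _ (MvPolynomial.X i))

/-- The variable `Tⱼ` in `K♯_𝔔`. [cite: Kato1994, (10.3)] -/
abbrev Tvar (j : Fin (refineRank hQ χ 𝔓)) : KL ℌ 𝒟 := kvar ℌ 𝒟 (Fin.castAdd _ j)

/-- `Λ ∘ toK = ρ`. [cite: Kato1994, (10.3)] -/
theorem Lam_toK (a : TorusLoc A hQ χ 𝔓 π₀) : LamH ℌ 𝒟 (toK ℌ 𝒟 a) = rho A hQ χ 𝔓 π₀ a := by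
  rw [toK_apply, LamH, Lam_C]

/-- `Λ(Xᵢ) = tvecᵢ`. [cite: Kato1994, (10.3)] -/
theorem Lam_kvar (i : Fin (refineRank hQ χ 𝔓 + (𝒟.d + 𝒟.h))) :
    LamH ℌ 𝒟 (kvar ℌ 𝒟 i) = tvec 𝒟 i := by
  rw [kvar, LamH, Lam_X]

/-- `Λ(Tⱼ) = χ(b_{i_j})`. [cite: Kato1994, (10.3)] -/
theorem Lam_Tvar (j : Fin (refineRank hQ χ 𝔓)) :
    LamH ℌ 𝒟 (Tvar ℌ 𝒟 j) =
      chiLoc χ 𝔓 (Multiplicative.ofAdd ⟨b (nonUnitIdx hQ χ 𝔓 j), hQ.basis_mem _⟩) := by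
  rw [Tvar, Lam_kvar, tvec, Fin.append_left]

/-- **`𝔪_{K♯_𝔔}` is generated by the variables.** [cite: Kato1994, (10.3)] -/
theorem maximalIdeal_KL_eq : maximalIdeal (KL ℌ 𝒟) = Ideal.span (Set.range (kvar ℌ 𝒟)) := by
  rw [← Localization.AtPrime.map_eq_maximalIdeal]
  have h1 := congrArg (Ideal.map (algebraMap (KRing 𝒟) (KL ℌ 𝒟)))
    (KPoint_eq_span ℌ.le ℌ.chi ℌ.proj_zero 𝒟)
  rw [h1, Ideal.map_span, ← Set.range_comp]
  rfl

/-- **The variables are non-zero in `K♯_𝔔`** (a regular local ring of dimension `N + d + h`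
whose maximal ideal they generate). [cite: Kato1994, (10.3)] -/
theorem kvar_ne_zero [IsNoetherianRing A] (i : Fin (refineRank hQ χ 𝔓 + (𝒟.d + 𝒟.h))) :
    kvar ℌ 𝒟 i ≠ 0 := by
  have hdim : ringKrullDim (KL ℌ 𝒟) = (refineRank hQ χ 𝔓 + (𝒟.d + 𝒟.h) : ℕ) :=
    ringKrullDim_KL ℌ 𝒟
  exact ne_zero_of_span_range_eq_maximalIdeal (R := KL ℌ 𝒟) _ (maximalIdeal_KL_eq ℌ 𝒟).symm
    hdim i

/-! ### The relations of `K♯` in `K♯_𝔔` -/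

/-- **`toK(φ₁(e p)) = ∏ⱼ Tⱼ^{c(e p)ⱼ}`** in `K♯_𝔔`. [cite: Kato1994, (10.3)] -/
theorem toK_twisted_embHom (p : P) :
    toK ℌ 𝒟 (twisted hQ χ 𝔓 π₀ he (LogChart.embHom he p)) =
      ∏ j, Tvar ℌ 𝒟 j ^ (refineMap hQ χ 𝔓 he (LogChart.embHom he p) j) := by
  classical
  have hw : absorbGlue n (𝒟.d + 𝒟.h) (LogChart.embHom he p, 0) ∈ absMonoid 𝒟 :=
    absorbGlue_mem ((LogChart.mem_embMonoid he).2 ⟨p, rfl⟩) 0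
  have hrel := mk_C_eq_mk_monomial (absChart 𝒟) (absMap 𝒟) (absMonoid 𝒟) hw
  rw [absChart_absorbGlue_zero] at hrel
  have hmap : absMap 𝒟 (absorbGlue n (𝒟.d + 𝒟.h) (LogChart.embHom he p, 0)) =
      Finsupp.mapDomain (Fin.castAdd (𝒟.d + 𝒟.h)) (refineMap hQ χ 𝔓 he (LogChart.embHom he p)) := by
    rw [absMap_absorbGlue]
    simp [absorbGlue]
  rw [hmap, MvPolynomial.monomial_eq, MvPolynomial.C_1, one_mul,
    Finsupp.prod_mapDomain_index_inj (Fin.castAdd_injective _ _)] at hrel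
  rw [toK_apply, hrel, map_finsuppProd, map_finsuppProd,
    Finsupp.prod_fintype _ _ fun j => by rw [pow_zero, map_one, map_one]]
  simp only [map_pow]
  rfl

/-- `toK(t_k) = X_{N+k}` in `K♯_𝔔` (the absorbed parameters). [cite: Kato1994, (10.3)] -/
theorem toK_params (k : Fin (𝒟.d + 𝒟.h)) : toK ℌ 𝒟 (params 𝒟 k) = kvar ℌ 𝒟 (Fin.natAdd _ k) := by
  classical
  have hw : absorbGlue n (𝒟.d + 𝒟.h) (0, Finsupp.single k 1) ∈ absMonoid 𝒟 :=
    absorbGlue_mem (zero_mem _) _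
  have hrel := mk_C_eq_mk_monomial (absChart 𝒟) (absMap 𝒟) (absMonoid 𝒟) hw
  rw [absChart_absorbGlue_single ℌ.le ℌ.chi ℌ.proj_zero 𝒟] at hrel
  have hmap : absMap 𝒟 (absorbGlue n (𝒟.d + 𝒟.h) (0, Finsupp.single k 1)) =
      Finsupp.single (Fin.natAdd _ k) 1 := by
    rw [absMap_absorbGlue, refineMap_zero hQ χ 𝔓 ℌ.le ℌ.chi he]
    simp [absorbGlue, Finsupp.mapDomain_single]
  rw [hmap, ← MvPolynomial.X_pow_eq_monomial, pow_one] at hrel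
  rw [toK_apply, hrel, kvar]

/-! ### The fraction field and the base map `gA : A → L` -/

/-- The fraction field `L` of the domain `K♯_𝔔`. [cite: Kato1994, (10.3)] -/
abbrev Frac : Type u := FractionRing (KL ℌ 𝒟)

/-- The embedding `ι : K♯_𝔔 ↪ L`. [cite: Kato1994, (10.3)] -/
def iotaL : KL ℌ 𝒟 →+* Frac ℌ 𝒟 := algebraMap (KL ℌ 𝒟) (Frac ℌ 𝒟)

/-- `ι` is the algebra map. [cite: Kato1994, (10.3)] -/
theorem iotaL_apply (x : KL ℌ 𝒟) : iotaL ℌ 𝒟 x = algebraMap (KL ℌ 𝒟) (Frac ℌ 𝒟) x := rfl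

/-- `A₁ → L`. [cite: Kato1994, (10.3)] -/
def toL : TorusLoc A hQ χ 𝔓 π₀ →+* Frac ℌ 𝒟 := (iotaL ℌ 𝒟).comp (toK ℌ 𝒟)

/-- `A_𝔭 → L`. [cite: Kato1994, (10.3)] -/
def gBase : BaseLoc A 𝔓 →+* Frac ℌ 𝒟 := (toL ℌ 𝒟).comp (baseMap A hQ χ 𝔓 π₀)

/-- **`gA : A → L`**, the structure map of the fraction field of `K♯_𝔔` as an `A`-algebra.
[cite: Kato1994, (10.3)] -/
def gA : A →+* Frac ℌ 𝒟 := (gBase ℌ 𝒟).comp (algebraMap A (BaseLoc A 𝔓))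

/-- `toL` unfolded. [cite: Kato1994, (10.3)] -/
theorem toL_apply (a : TorusLoc A hQ χ 𝔓 π₀) : toL ℌ 𝒟 a = iotaL ℌ 𝒟 (toK ℌ 𝒟 a) := rfl

/-- `gBase` unfolded. [cite: Kato1994, (10.3)] -/
theorem gBase_apply (x : BaseLoc A 𝔓) : gBase ℌ 𝒟 x = toL ℌ 𝒟 (baseMap A hQ χ 𝔓 π₀ x) := rfl

/-- `gA` unfolded. [cite: Kato1994, (10.3)] -/
theorem gA_apply (a : A) : gA ℌ 𝒟 a = gBase ℌ 𝒟 (algebraMap A (BaseLoc A 𝔓) a) := rfl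

/-- `ι : K♯_𝔔 → L` is injective. [cite: Kato1994, (10.3)] -/
theorem iotaL_injective [IsNoetherianRing A] : Function.Injective (iotaL ℌ 𝒟) :=
  IsFractionRing.injective (KL ℌ 𝒟) _

include 𝒟 in
/-- `baseMap(φ(p)) = φ₁(e p) · u(e p) · v` in `A₁`. [cite: Kato1994, (10.3)] -/
theorem baseMap_phi_eq (p : P) :
    ∃ v : (BaseLoc A 𝔓)ˣ, baseMap A hQ χ 𝔓 π₀ (algebraMap A (BaseLoc A 𝔓) (φ (Multiplicative.ofAdd p))) =
      twisted hQ χ 𝔓 π₀ he (LogChart.embHom he p) *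
        ↑(twistUnits hQ χ 𝔓 π₀ he (LogChart.embHom he p)) * baseMap A hQ χ 𝔓 π₀ ↑v := by
  obtain ⟨v, hv⟩ := 𝒟.compat p
  rw [LogChart.val_of_mem P φ p.2] at hv
  refine ⟨v, ?_⟩
  rw [← hv, map_mul, twisted_apply, mul_assoc ((baseMap A hQ χ 𝔓 π₀) _), Units.inv_mul, mul_one]

/-- **`φ(p) ≠ 0` in `L`**: `φ(p) = φ₁(e p)·u·v` with `φ₁(e p)` a product of the non-zero `Tⱼ`.
[cite: Kato1994, Thm. (4.1)] -/
theorem gA_phi_ne_zero [IsNoetherianRing A] (p : P) : gA ℌ 𝒟 (φ (Multiplicative.ofAdd p)) ≠ 0 := by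
  obtain ⟨v, h1⟩ := baseMap_phi_eq 𝒟 p
  rw [gA_apply, gBase_apply, h1, map_mul, map_mul, toL_apply, toK_twisted_embHom ℌ 𝒟]
  refine mul_ne_zero (mul_ne_zero ?_ ?_) ?_
  · rw [map_ne_zero_iff _ (iotaL_injective ℌ 𝒟)]
    exact Finset.prod_ne_zero_iff.2 fun j _ => pow_ne_zero _ (kvar_ne_zero ℌ 𝒟 _)
  · exact ((twistUnits hQ χ 𝔓 π₀ he (LogChart.embHom he p)).isUnit.map (toL ℌ 𝒟)).ne_zero
  · exact ((v.isUnit.map (baseMap A hQ χ 𝔓 π₀)).map (toL ℌ 𝒟)).ne_zero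

/-! ### The group envelope `Θ : ℤⁿ → Lˣ` of `φ` -/

/-- `p ↦ φ(p)` as a homomorphism into `Lˣ`. [cite: Kato1994, (1.1)] -/
def phiUnits [IsNoetherianRing A] : Multiplicative P →* (Frac ℌ 𝒟)ˣ where
  toFun p := Units.mk0 (gA ℌ 𝒟 (φ p)) (gA_phi_ne_zero ℌ 𝒟 p)
  map_one' := by ext; simp
  map_mul' p q := by ext; simp

/-- **The group envelope** `Θ : ℤⁿ → Lˣ` of `p ↦ φ(p)` (Kato (1.1), `Pᵍᵖ = ℤⁿ`).
[cite: Kato1994, (1.1)] -/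
def envelope [IsNoetherianRing A] : (Fin n → ℤ) →+ Additive (Frac ℌ 𝒟)ˣ :=
  (exists_addMonoidHom_extend P ℌ.span_eq (phiUnits ℌ 𝒟)).choose

/-- `Θ(p) = φ(p)` for `p ∈ P`. [cite: Kato1994, (1.1)] -/
theorem coe_envelope_of_mem [IsNoetherianRing A] {p : Fin n → ℤ} (hp : p ∈ P) :
    ((Additive.toMul (envelope ℌ 𝒟 p) : (Frac ℌ 𝒟)ˣ) : Frac ℌ 𝒟) =
      gA ℌ 𝒟 (φ (Multiplicative.ofAdd ⟨p, hp⟩)) := by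
  have h := (exists_addMonoidHom_extend P ℌ.span_eq (phiUnits ℌ 𝒟)).choose_spec p hp
  rw [envelope, h, toMul_ofMul]
  rfl

/-- **Any `A`-algebra map `ω : C → L` sends `χ(q)` to `Θ(q)`** (`q = p₁ − p₂` with `pᵢ ∈ P`).
[cite: Kato1994, (1.1), (10.3)] -/
theorem omega_chi [IsNoetherianRing A] (ω : C →+* Frac ℌ 𝒟) (hω : ω.comp (algebraMap A C) = gA ℌ 𝒟)
    {q : Fin n → ℤ} (hq : q ∈ Q) :
    ω (χ (Multiplicative.ofAdd ⟨q, hq⟩)) =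
      ((Additive.toMul (envelope ℌ 𝒟 q) : (Frac ℌ 𝒟)ˣ) : Frac ℌ 𝒟) := by
  obtain ⟨p₁, hp₁, p₂, hp₂, rfl⟩ := (LogChart.mem_span_int_iff_exists_sub P).1
    (show q ∈ Submodule.span ℤ (P : Set (Fin n → ℤ)) by rw [ℌ.span_eq]; exact Submodule.mem_top)
  have hωP : ∀ (p : Fin n → ℤ) (hp : p ∈ P), ω (χ (Multiplicative.ofAdd ⟨p, ℌ.le hp⟩)) =
      gA ℌ 𝒟 (φ (Multiplicative.ofAdd ⟨p, hp⟩)) := by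
    intro p hp
    rw [ℌ.chi ⟨p, hp⟩, ← RingHom.comp_apply, hω]
  have hmul : χ (Multiplicative.ofAdd ⟨p₁ - p₂, hq⟩) * χ (Multiplicative.ofAdd ⟨p₂, ℌ.le hp₂⟩) =
      χ (Multiplicative.ofAdd ⟨p₁, ℌ.le hp₁⟩) := by
    rw [← map_mul, ← ofAdd_add]
    congr 2
    apply Subtype.ext
    simp
  have h2 := congrArg ω hmul
  rw [map_mul, hωP p₂ hp₂, hωP p₁ hp₁, ← coe_envelope_of_mem ℌ 𝒟 hp₂,
    ← coe_envelope_of_mem ℌ 𝒟 hp₁] at h2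
  rw [map_sub, toMul_sub, Units.val_div_eq_div_val, eq_div_iff (Units.ne_zero _), h2]

/-! ### The monomial map `Ξ : ℤⁿ → Lˣ` -/

/-- `Tⱼ` as a unit of `L`. [cite: Kato1994, (10.3)] -/
def TL [IsNoetherianRing A] (j : Fin (refineRank hQ χ 𝔓)) : (Frac ℌ 𝒟)ˣ :=
  Units.mk0 (iotaL ℌ 𝒟 (Tvar ℌ 𝒟 j)) (by
    rw [map_ne_zero_iff _ (iotaL_injective ℌ 𝒟)]
    exact kvar_ne_zero ℌ 𝒟 _)

/-- The value of `TL`. [cite: Kato1994, (10.3)] -/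
theorem coe_TL [IsNoetherianRing A] (j : Fin (refineRank hQ χ 𝔓)) :
    ((TL ℌ 𝒟 j : (Frac ℌ 𝒟)ˣ) : Frac ℌ 𝒟) = iotaL ℌ 𝒟 (Tvar ℌ 𝒟 j) := rfl

/-- `X_k` as a unit of `L`. [cite: Kato1994, (10.3)] -/
def XL (k : Fin (torusRank hQ χ 𝔓 π₀)) : (Frac ℌ 𝒟)ˣ :=
  Units.map (toL ℌ 𝒟 : TorusLoc A hQ χ 𝔓 π₀ →* Frac ℌ 𝒟) (xUnit A hQ χ 𝔓 π₀ k)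

/-- The value of `XL`. [cite: Kato1994, (10.3)] -/
theorem coe_XL (k : Fin (torusRank hQ χ 𝔓 π₀)) :
    ((XL ℌ 𝒟 k : (Frac ℌ 𝒟)ˣ) : Frac ℌ 𝒟) = toL ℌ 𝒟 (xUnit A hQ χ 𝔓 π₀ k : TorusLoc A hQ χ 𝔓 π₀) :=
  rfl

/-- **The monomial map** `Ξ(x) = ∏ⱼ Tⱼ^{b*_{i_j}(x)} · ∏_k X_k^{b′_k(x)} ∈ Lˣ`.
[cite: Kato1994, (10.3)] -/
def xi [IsNoetherianRing A] : (Fin n → ℤ) →+ Additive (Frac ℌ 𝒟)ˣ where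
  toFun x := (∑ j, b.repr x (nonUnitIdx hQ χ 𝔓 j) • Additive.ofMul (TL ℌ 𝒟 j)) +
    ∑ k, torusCoord hQ χ 𝔓 π₀ x k • Additive.ofMul (XL ℌ 𝒟 k)
  map_zero' := by simp
  map_add' x y := by
    simp only [map_add, Finsupp.add_apply, add_zsmul, Finset.sum_add_distrib]
    abel

/-- `Ξ` unfolded. [cite: Kato1994, (10.3)] -/
theorem xi_apply [IsNoetherianRing A] (x : Fin n → ℤ) :
    xi ℌ 𝒟 x = (∑ j, b.repr x (nonUnitIdx hQ χ 𝔓 j) • Additive.ofMul (TL ℌ 𝒟 j)) +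
      ∑ k, torusCoord hQ χ 𝔓 π₀ x k • Additive.ofMul (XL ℌ 𝒟 k) := rfl

/-- `toL(X^{b′(x)}) = ∏ X_k^{b′_k(x)}` in `Lˣ`. [cite: Kato1994, (10.3)] -/
theorem units_map_toL_torusMonomial (x : Fin n → ℤ) :
    Units.map (toL ℌ 𝒟 : TorusLoc A hQ χ 𝔓 π₀ →* Frac ℌ 𝒟)
        (Additive.toMul (torusMonomial A hQ χ 𝔓 π₀ x)) =
      Additive.toMul (∑ k, torusCoord hQ χ 𝔓 π₀ x k • Additive.ofMul (XL ℌ 𝒟 k)) := by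
  rw [torusMonomial_apply]
  simp only [toMul_sum, toMul_zsmul, toMul_ofMul, map_prod, map_zpow]
  rfl

/-! ### The relation `Ξ = Θ ∘ π'` -/

set_option maxHeartbeats 400000 in
/-- `gBase(φ̄(π' p)) = Ξ(p)`: the relation `φ₁(e p) = T^{c(e p)}` of `K♯` read in `L`.
[cite: Kato1994, (10.3)] -/
theorem gBase_sharpChart_proj' [IsNoetherianRing A] (p : P) :
    gBase ℌ 𝒟 (LogChart.sharpChart P φ (𝔓.comap (algebraMap A C)) (proj' hQ χ 𝔓 π₀ (p : Fin n → ℤ))) =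
      ((Additive.toMul (xi ℌ 𝒟 (p : Fin n → ℤ)) : (Frac ℌ 𝒟)ˣ) : Frac ℌ 𝒟) := by
  have hπ'0 : ∀ v ∈ Submodule.span ℤ
      (LogChart.faceMonoid P φ (𝔓.comap (algebraMap A C)) : Set (Fin n → ℤ)),
      proj' hQ χ 𝔓 π₀ v = 0 := fun v hv => proj'_eq_zero_of_mem_span hQ χ 𝔓 ℌ.le ℌ.chi π₀ ℌ.proj_zero hv
  have h2 : baseMap A hQ χ 𝔓 π₀
      (LogChart.sharpChart P φ (𝔓.comap (algebraMap A C)) (proj' hQ χ 𝔓 π₀ (p : Fin n → ℤ))) =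
      twisted hQ χ 𝔓 π₀ he (LogChart.embHom he p) *
        ↑(Additive.toMul (torusMonomial A hQ χ 𝔓 π₀ (p : Fin n → ℤ))) := by
    rw [twisted_apply, LogChart.embChart_embHom he hπ'0,
      twistUnits_embHom hQ χ 𝔓 ℌ.le ℌ.chi π₀ ℌ.proj_zero he, mul_assoc, Units.inv_mul, mul_one]
  rw [gBase_apply, h2, map_mul, toL_apply, toK_twisted_embHom ℌ 𝒟, map_prod,
    ← MonoidHom.coe_coe (toL ℌ 𝒟), ← Units.coe_map, units_map_toL_torusMonomial, xi_apply, toMul_add,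
    Units.val_mul]
  congr 1
  rw [toMul_sum, Units.coe_prod]
  refine Finset.prod_congr rfl fun j _ => ?_
  rw [map_pow, toMul_zsmul, toMul_ofMul, ← refineMap_embHom_cast hQ χ 𝔓 ℌ.le ℌ.chi he p j,
    zpow_natCast, Units.val_pow_eq_pow_val, coe_TL]

/-- **The key identity `Ξ(p) = Θ(π' p)` for `p ∈ P`**: combine `gBase(φ̄(π' p)) = Ξ(p)` with
`φ̄(π' p)·φ(f₁) = φ(p + f₂)`. [cite: Kato1994, (10.3)] -/
theorem xi_of_mem [IsNoetherianRing A] (p : P) :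
    xi ℌ 𝒟 (p : Fin n → ℤ) = envelope ℌ 𝒟 (proj' hQ χ 𝔓 π₀ (p : Fin n → ℤ)) := by
  have hπ'1 := sub_proj'_mem_span hQ χ 𝔓 π₀ ℌ.sub_proj
  obtain ⟨f₁, hf₁, f₂, hf₂, h3⟩ :=
    LogChart.exists_presentation_proj (P := P) (φ := φ) (𝔭 := 𝔓.comap (algebraMap A C)) hπ'1
      (p : Fin n → ℤ)
  have hmul := LogChart.sharpChart_mul_of_eq_sub P φ (𝔓.comap (algebraMap A C))
    (P.add_mem p.2 hf₂.1) hf₁ h3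
  have h4 := congrArg (gBase ℌ 𝒟) hmul
  rw [map_mul, gBase_sharpChart_proj' ℌ 𝒟, LogChart.val_of_mem P φ hf₁.1,
    LogChart.val_of_mem P φ (P.add_mem p.2 hf₂.1), ← gA_apply, ← gA_apply,
    ← coe_envelope_of_mem ℌ 𝒟 hf₁.1, ← coe_envelope_of_mem ℌ 𝒟 (P.add_mem p.2 hf₂.1),
    ← Units.val_mul] at h4
  have h5 := Units.ext h4
  rw [← toMul_add, Additive.toMul.injective.eq_iff] at h5
  rw [h3, map_sub, ← h5, add_sub_cancel_right]

/-- **`Ξ = Θ ∘ π'` on all of `ℤⁿ`** (`P` spans). [cite: Kato1994, (10.3)] -/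
theorem xi_eq_envelope_proj' [IsNoetherianRing A] (x : Fin n → ℤ) :
    xi ℌ 𝒟 x = envelope ℌ 𝒟 (proj' hQ χ 𝔓 π₀ x) := by
  have h := addMonoidHom_ext_of_span_eq_top P ℌ.span_eq (Θ := xi ℌ 𝒟)
    (Θ' := (envelope ℌ 𝒟).comp (proj' hQ χ 𝔓 π₀).toAddMonoidHom) fun s hs => xi_of_mem ℌ 𝒟 ⟨s, hs⟩
  exact DFunLike.congr_fun h x

/-- **`Tⱼ = Θ(b_{i_j})` in `L`.** [cite: Kato1994, (10.3)] -/
theorem TL_eq [IsNoetherianRing A] (j : Fin (refineRank hQ χ 𝔓)) :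
    TL ℌ 𝒟 j = Additive.toMul (envelope ℌ 𝒟 (b (nonUnitIdx hQ χ 𝔓 j))) := by
  have h := xi_eq_envelope_proj' ℌ 𝒟 (b (nonUnitIdx hQ χ 𝔓 j))
  rw [proj'_basis_of_not_mem hQ χ 𝔓 π₀ (nonUnitIdx_not_mem hQ χ 𝔓 j), xi_apply] at h
  have htor : torusCoord hQ χ 𝔓 π₀ (b (nonUnitIdx hQ χ 𝔓 j)) = 0 := by
    rw [torusCoord_apply, LinearEquiv.map_eq_zero_iff]
    apply Subtype.ext
    show π₀ (b (nonUnitIdx hQ χ 𝔓 j) - sigma hQ χ 𝔓 (b (nonUnitIdx hQ χ 𝔓 j))) = 0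
    rw [sigma_basis_of_not_mem hQ χ 𝔓 (nonUnitIdx_not_mem hQ χ 𝔓 j), sub_self, map_zero]
  rw [htor] at h
  simp only [Finsupp.zero_apply, zero_smul, Finset.sum_const_zero, add_zero,
    Module.Basis.repr_self_apply, (nonUnitIdx_injective hQ χ 𝔓).eq_iff] at h
  simp only [ite_smul, one_smul, zero_smul, Finset.sum_ite_eq, Finset.mem_univ, if_true] at h
  exact Additive.ofMul.injective h

include ℌ in
/-- The torus basis vectors are fixed by `π₀`. [cite: Kato1994, (10.3)] -/
theorem proj_torusBasis (k : Fin (torusRank hQ χ 𝔓 π₀)) :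
    π₀ ((torusBasis hQ χ 𝔓 π₀ k : torusLattice hQ χ 𝔓 π₀) : Fin n → ℤ) =
      ((torusBasis hQ χ 𝔓 π₀ k : torusLattice hQ χ 𝔓 π₀) : Fin n → ℤ) := by
  obtain ⟨h', -, hyy⟩ := Submodule.mem_map.1 (torusBasis hQ χ 𝔓 π₀ k).2
  rw [← hyy, ℌ.proj_proj]

/-- **`X_k = Θ(h′_k)` in `L`.** [cite: Kato1994, (10.3)] -/
theorem XL_eq [IsNoetherianRing A] (k : Fin (torusRank hQ χ 𝔓 π₀)) :
    XL ℌ 𝒟 k = Additive.toMul (envelope ℌ 𝒟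
      ((torusBasis hQ χ 𝔓 π₀ k : torusLattice hQ χ 𝔓 π₀) : Fin n → ℤ)) := by
  have hyH : ((torusBasis hQ χ 𝔓 π₀ k : torusLattice hQ χ 𝔓 π₀) : Fin n → ℤ) ∈ hsub hQ χ 𝔓 :=
    torusLattice_le_hsub hQ χ 𝔓 ℌ.le ℌ.chi π₀ ℌ.sub_proj (torusBasis hQ χ 𝔓 π₀ k).2
  have h := xi_eq_envelope_proj' ℌ 𝒟 ((torusBasis hQ χ 𝔓 π₀ k : torusLattice hQ χ 𝔓 π₀) : Fin n → ℤ)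
  rw [proj'_of_repr hQ χ 𝔓 π₀ (fun i hi => hyH i hi), xi_apply,
    torusCoord_coe hQ χ 𝔓 ℌ.le ℌ.chi π₀ ℌ.sub_proj ℌ.proj_proj, Module.Basis.repr_self,
    proj_torusBasis ℌ] at h
  have hzero : ∀ j, b.repr ((torusBasis hQ χ 𝔓 π₀ k : torusLattice hQ χ 𝔓 π₀) : Fin n → ℤ)
      (nonUnitIdx hQ χ 𝔓 j) = 0 := fun j => hyH _ (nonUnitIdx_not_mem hQ χ 𝔓 j)
  simp only [hzero, zero_smul, Finset.sum_const_zero, zero_add, Finsupp.single_apply] at h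
  simp only [ite_smul, one_smul, zero_smul, Finset.sum_ite_eq, Finset.mem_univ, if_true] at h
  exact Additive.ofMul.injective h

end LogRefinedChart

end Literature.AlgebraicGeometry.Resolution
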